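import Summits.HodgeConjecture.CorCM.Model.TopDegreeDeterminant
import Summits.HodgeConjecture.CorCM.KunnethDegreeOne
import Literature.AlgebraicGeometry.HodgeTheory.BettiUniverseCMAction
import HarnessLib

/-!
# COR-CM model layer, part 3b: the degree of the diagonal action (`Fact_deg_diag`) on the
# Picard–CM model universe

Cell `pub-hodgecm2` (COR-CM), seat `model-1`; row M19 of `BINDER-OWNERS.md` = stage-1 `ModelAxioms` field 27
`Fact_deg_diag` (`HodgeCM/Geometry/Facts.lean` l.224, FACTS.md §1 M27; READ by rfwf Prop 2.2,
`Proofs/Prop22/Algebraic.Bc_pull_pull`):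

  for the product `P = A₀ × A₁ × A₂ × A₃` of four CM abelian varieties `Aᵢ = A_{(K,Φᵢ)}` and a morphism
  `M : P → P` ACTING DIAGONALLY BY `a ∈ K` (`IsDiagAct`: `M^* ∘ prᵢ^* = prᵢ^* ∘ eᵢ^*` with `eᵢ^* = ι(a)` on `H¹(Aᵢ, ℚ)`),
  `tr_P ∘ M^* = N_{K/ℚ}(a)⁴ · tr_P` on every `Hᵏ(P, ℚ)`.

PROOF on the model (tree objects `PicardCM.Var`, `BettiUniverse.tr/pull`, `BettiUniverse.cmEndAction`):
* part 3a (`TopDegreeDeterminant`): `tr ∘ M^* = det(M^*|_{H¹(P;ℚ)}) • tr` (`H^{2 dim P} = ⋀^{top} H¹` for the abelian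
  variety `P`; off the top degree both sides vanish);
* Künneth in degree one for the four factors (`kunneth_one_bijective₄`, from the cell's binary
  `kunneth_one_bijective`): `⊕ᵢ prᵢ^* : ⊕ᵢ H¹(Aᵢ; ℚ) ≅ H¹(P; ℚ)` intertwines `⊕ᵢ eᵢ^*` with `M^*`, so
  `det M^* = ∏ᵢ det eᵢ^*` (`det_eq_prod_of_coprod₄`: `LinearMap.det_conj`, `LinearMap.det_prodMap`);
* `det(ι(a) | H¹(Aᵢ; ℚ)) = N_{K/ℚ}(a)` (`det_eq_norm_of_algHom`): `H¹(Aᵢ; ℚ)` is a `K`-line (`dim_ℚ = [K:ℚ]`: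
  record (iii) `finrank_eq` + universal coefficients), `x ↦ ι(x) v` is a `ℚ`-isomorphism `K ≅ H¹` carrying
  multiplication by `a` to `ι(a)`, and `N_{K/ℚ}(a) = det(a · )` (`Algebra.norm_apply`).
Print shape: Lange, *Abelian Varieties over ℂ* §1.1 (rational representation, degree), Mumford §19 Thm. 4.
-/

noncomputable section

open scoped TensorProduct
open CategoryTheory MonoidalCategory CartesianMonoidalCategory
open Literature.AlgebraicTopology.SingularHomology
open Literature.AlgebraicGeometry.Motives (SchemeOver ComplexPoints IsSmoothProjective bettiCohomology AbelianVariety)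
open Literature.AlgebraicGeometry.HodgeTheory
open Literature.NumberTheory.Automorphic.PicardCM

namespace Summit.HodgeConjecture.CorCM.Model

/-! ### Linear algebra -/

/-- **`det ι(k) = N_{K/ℚ}(k)` on a `K`-line.**  For a `ℚ`-algebra map `ι : K → End_ℚ V` from a field of finite
degree with `dim_ℚ V = [K:ℚ]`, the `ℚ`-determinant of `ι(k)` is the norm of `k`: for `v ≠ 0` the map
`x ↦ ι(x) v` is an isomorphism `K ≅ V` (injective: its kernel is a proper ideal of a field; dimensions agree)
carrying left multiplication by `k` to `ι(k)`, and `N(k) = det(x ↦ k x)` (`Algebra.norm_apply`). -/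
theorem det_eq_norm_of_algHom {K V : Type*} [Field K] [Algebra ℚ K] [FiniteDimensional ℚ K]
    [AddCommGroup V] [Module ℚ V] [FiniteDimensional ℚ V]
    (ι : K →ₐ[ℚ] Module.End ℚ V) (hV : Module.finrank ℚ V = Module.finrank ℚ K) (k : K) :
    LinearMap.det (ι k) = Algebra.norm ℚ k := by
  have hpos : 0 < Module.finrank ℚ V := by rw [hV]; exact Module.finrank_pos
  obtain ⟨v, hv⟩ := Module.finrank_pos_iff_exists_ne_zero.1 hpos
  let ε : K →ₗ[ℚ] V :=
    { toFun := fun x ↦ ι x v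
      map_add' := fun x y ↦ by rw [map_add, LinearMap.add_apply]
      map_smul' := fun q x ↦ by rw [map_smul, LinearMap.smul_apply, RingHom.id_apply] }
  have hε : ∀ x, ε x = ι x v := fun _ ↦ rfl
  have hinj : Function.Injective ε := by
    rw [← LinearMap.ker_eq_bot, LinearMap.ker_eq_bot']
    intro x hx
    by_contra hx0
    apply hv
    have h1 : ι (x⁻¹ * x) v = 0 := by rw [map_mul, Module.End.mul_apply, ← hε x, hx, map_zero]
    rwa [inv_mul_cancel₀ hx0, map_one, Module.End.one_apply] at h1
  have hbij : Function.Bijective ε :=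
    ⟨hinj, (LinearMap.injective_iff_surjective_of_finrank_eq_finrank hV.symm).1 hinj⟩
  let E : K ≃ₗ[ℚ] V := LinearEquiv.ofBijective ε hbij
  have hconj : ι k = (E : K →ₗ[ℚ] V) ∘ₗ Algebra.lmul ℚ K k ∘ₗ (E.symm : V →ₗ[ℚ] K) := by
    refine LinearMap.ext fun w ↦ ?_
    obtain ⟨x, rfl⟩ := E.surjective w
    rw [LinearMap.comp_apply, LinearMap.comp_apply, LinearEquiv.coe_coe, LinearEquiv.coe_coe,
      E.symm_apply_apply]
    change ι k (ε x) = ε (k * x)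
    rw [hε, hε, map_mul, Module.End.mul_apply]
  rw [hconj, LinearMap.det_conj, Algebra.norm_apply]

/-- `(A ⊕ B) ∘ (Φ × Ψ) = (A ∘ Φ) ⊕ (B ∘ Ψ)` for linear maps out of a binary product. -/
theorem coprod_comp_prodMap' {R V V' W W' U : Type*} [CommRing R] [AddCommGroup V] [Module R V] [AddCommGroup V']
    [Module R V'] [AddCommGroup W] [Module R W] [AddCommGroup W'] [Module R W'] [AddCommGroup U] [Module R U]
    (A : V' →ₗ[R] U) (B : W' →ₗ[R] U) (Φ : V →ₗ[R] V') (Ψ : W →ₗ[R] W') :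
    (A.coprod B) ∘ₗ (Φ.prodMap Ψ) = (A ∘ₗ Φ).coprod (B ∘ₗ Ψ) := by
  refine LinearMap.ext fun x ↦ ?_
  simp only [LinearMap.coe_comp, Function.comp_apply, LinearMap.coprod_apply, LinearMap.prodMap_apply]

/-- If `Ψ : V → W` is a linear bijection intertwining `g ∈ End V` with `G ∈ End W` (`G ∘ Ψ = Ψ ∘ g`) then
`det G = det g` (`LinearMap.det_conj`). -/
theorem det_eq_of_bijective_intertwine {V W : Type*} [AddCommGroup V] [Module ℚ V] [AddCommGroup W]
    [Module ℚ W] (Ψ : V →ₗ[ℚ] W) (hΨ : Function.Bijective Ψ) (g : Module.End ℚ V) (G : Module.End ℚ W)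
    (h : G ∘ₗ Ψ = Ψ ∘ₗ g) : LinearMap.det G = LinearMap.det g := by
  let E := LinearEquiv.ofBijective Ψ hΨ
  have hG : G = (E : V →ₗ[ℚ] W) ∘ₗ g ∘ₗ (E.symm : W →ₗ[ℚ] V) := by
    refine LinearMap.ext fun w ↦ ?_
    obtain ⟨v, rfl⟩ := E.surjective w
    rw [LinearMap.comp_apply, LinearMap.comp_apply, LinearEquiv.coe_coe, LinearEquiv.coe_coe,
      E.symm_apply_apply]
    exact LinearMap.congr_fun h v
  rw [hG, LinearMap.det_conj]

/-- **Determinant of an endomorphism block-diagonal along a bijective four-fold sum**: if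
`Ψ = ψ₀ ⊕ ψ₁ ⊕ ψ₂ ⊕ ψ₃ : V₀ × V₁ × V₂ × V₃ → W` (left-nested) is bijective and `G ∘ ψᵢ = ψᵢ ∘ gᵢ`, then
`det G = det g₀ · det g₁ · det g₂ · det g₃`. -/
theorem det_eq_prod_of_coprod₄ {V₀ V₁ V₂ V₃ W : Type*} [AddCommGroup V₀] [Module ℚ V₀]
    [AddCommGroup V₁] [Module ℚ V₁] [AddCommGroup V₂] [Module ℚ V₂] [AddCommGroup V₃] [Module ℚ V₃]
    [AddCommGroup W] [Module ℚ W] [Module.Finite ℚ V₀] [Module.Finite ℚ V₁] [Module.Finite ℚ V₂]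
    [Module.Finite ℚ V₃]
    (ψ₀ : V₀ →ₗ[ℚ] W) (ψ₁ : V₁ →ₗ[ℚ] W) (ψ₂ : V₂ →ₗ[ℚ] W) (ψ₃ : V₃ →ₗ[ℚ] W)
    (hΨ : Function.Bijective (((ψ₀.coprod ψ₁).coprod ψ₂).coprod ψ₃))
    (g₀ : Module.End ℚ V₀) (g₁ : Module.End ℚ V₁) (g₂ : Module.End ℚ V₂) (g₃ : Module.End ℚ V₃)
    (G : Module.End ℚ W) (h₀ : G ∘ₗ ψ₀ = ψ₀ ∘ₗ g₀) (h₁ : G ∘ₗ ψ₁ = ψ₁ ∘ₗ g₁) (h₂ : G ∘ₗ ψ₂ = ψ₂ ∘ₗ g₂)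
    (h₃ : G ∘ₗ ψ₃ = ψ₃ ∘ₗ g₃) :
    LinearMap.det G = LinearMap.det g₀ * LinearMap.det g₁ * LinearMap.det g₂ * LinearMap.det g₃ := by
  have hint : G ∘ₗ (((ψ₀.coprod ψ₁).coprod ψ₂).coprod ψ₃) =
      (((ψ₀.coprod ψ₁).coprod ψ₂).coprod ψ₃) ∘ₗ (((g₀.prodMap g₁).prodMap g₂).prodMap g₃) := by
    rw [coprod_comp_prodMap', coprod_comp_prodMap', coprod_comp_prodMap',
      LinearMap.comp_coprod, LinearMap.comp_coprod, LinearMap.comp_coprod, h₀, h₁, h₂, h₃]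
  rw [det_eq_of_bijective_intertwine _ hΨ _ _ hint, LinearMap.det_prodMap, LinearMap.det_prodMap,
    LinearMap.det_prodMap]

/-! ### Künneth in degree one for four factors -/

section Kunneth

variable {n₀ n₁ n₂ n₃ : ℕ} {X₀ X₁ X₂ X₃ : SchemeOver ℂ}

/-- A composite of two linear bijections, resp. a product with the identity, is bijective (coercion
bookkeeping for `∘ₗ` and `prodMap`). -/
theorem bijective_coprod_comp_prodMap_id {V V' W U : Type*} [AddCommGroup V] [Module ℚ V] [AddCommGroup V']
    [Module ℚ V'] [AddCommGroup W] [Module ℚ W] [AddCommGroup U] [Module ℚ U]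
    (A : V' →ₗ[ℚ] U) (B : W →ₗ[ℚ] U) (Φ : V →ₗ[ℚ] V') (hAB : Function.Bijective (A.coprod B))
    (hΦ : Function.Bijective Φ) :
    Function.Bijective ((A.coprod B) ∘ₗ (Φ.prodMap (LinearMap.id : W →ₗ[ℚ] W))) := by
  rw [LinearMap.coe_comp]
  refine hAB.comp ?_
  rw [LinearMap.coe_prodMap]
  exact hΦ.prodMap Function.bijective_id

/-- **Künneth in degree one for `((X₀ ⊗ X₁) ⊗ X₂) ⊗ X₃`**: the four pull-backs along the (left-nested)
projections identify `H¹(X₀; ℚ) ⊕ H¹(X₁; ℚ) ⊕ H¹(X₂; ℚ) ⊕ H¹(X₃; ℚ)` with `H¹` of the product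
(three applications of the cell's `kunneth_one_bijective`, Voisin I Thm. 11.38). The projections are
spelled as the package's `pr4`: `fst ≫ (fst ≫ fst)`, `fst ≫ (fst ≫ snd)`, `fst ≫ snd`, `snd`. -/
theorem kunneth_one_bijective₄ (h₀ : IsSmoothProjective n₀ X₀) (h₁ : IsSmoothProjective n₁ X₁)
    (h₂ : IsSmoothProjective n₂ X₂) (h₃ : IsSmoothProjective n₃ X₃) :
    Function.Bijective
      ((((BettiUniverse.pull (fst ((X₀ ⊗ X₁) ⊗ X₂) X₃ ≫ (fst (X₀ ⊗ X₁) X₂ ≫ fst X₀ X₁)) 1).coprod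
          (BettiUniverse.pull (fst ((X₀ ⊗ X₁) ⊗ X₂) X₃ ≫ (fst (X₀ ⊗ X₁) X₂ ≫ snd X₀ X₁)) 1)).coprod
          (BettiUniverse.pull (fst ((X₀ ⊗ X₁) ⊗ X₂) X₃ ≫ snd (X₀ ⊗ X₁) X₂) 1)).coprod
        (BettiUniverse.pull (snd ((X₀ ⊗ X₁) ⊗ X₂) X₃) 1)) := by
  have h01 := Literature.AlgebraicGeometry.Motives.IsSmoothProjective.tensor_holds h₀ h₁
  have h012 := Literature.AlgebraicGeometry.Motives.IsSmoothProjective.tensor_holds h01 h₂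
  have k₂ := kunneth_one_bijective h₀ h₁
  have k₃ := kunneth_one_bijective h01 h₂
  have k₄ := kunneth_one_bijective h012 h₃
  -- level three
  have e3 : ((BettiUniverse.pull (fst (X₀ ⊗ X₁) X₂ ≫ fst X₀ X₁) 1).coprod
        (BettiUniverse.pull (fst (X₀ ⊗ X₁) X₂ ≫ snd X₀ X₁) 1)).coprod (BettiUniverse.pull (snd (X₀ ⊗ X₁) X₂) 1) =
      ((BettiUniverse.pull (fst (X₀ ⊗ X₁) X₂) 1).coprod (BettiUniverse.pull (snd (X₀ ⊗ X₁) X₂) 1)) ∘ₗ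
        (((BettiUniverse.pull (fst X₀ X₁) 1).coprod (BettiUniverse.pull (snd X₀ X₁) 1)).prodMap LinearMap.id) := by
    rw [coprod_comp_prodMap', LinearMap.comp_id, LinearMap.comp_coprod, ← BettiUniverse.pull_comp,
      ← BettiUniverse.pull_comp]
  have b3 : Function.Bijective (((BettiUniverse.pull (fst (X₀ ⊗ X₁) X₂ ≫ fst X₀ X₁) 1).coprod
        (BettiUniverse.pull (fst (X₀ ⊗ X₁) X₂ ≫ snd X₀ X₁) 1)).coprod (BettiUniverse.pull (snd (X₀ ⊗ X₁) X₂) 1)) := by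
    rw [e3]; exact bijective_coprod_comp_prodMap_id _ _ _ k₃ k₂
  -- level four
  have e4 : (((BettiUniverse.pull (fst ((X₀ ⊗ X₁) ⊗ X₂) X₃ ≫ (fst (X₀ ⊗ X₁) X₂ ≫ fst X₀ X₁)) 1).coprod
          (BettiUniverse.pull (fst ((X₀ ⊗ X₁) ⊗ X₂) X₃ ≫ (fst (X₀ ⊗ X₁) X₂ ≫ snd X₀ X₁)) 1)).coprod
          (BettiUniverse.pull (fst ((X₀ ⊗ X₁) ⊗ X₂) X₃ ≫ snd (X₀ ⊗ X₁) X₂) 1)).coprod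
        (BettiUniverse.pull (snd ((X₀ ⊗ X₁) ⊗ X₂) X₃) 1) =
      ((BettiUniverse.pull (fst ((X₀ ⊗ X₁) ⊗ X₂) X₃) 1).coprod (BettiUniverse.pull (snd ((X₀ ⊗ X₁) ⊗ X₂) X₃) 1)) ∘ₗ
        ((((BettiUniverse.pull (fst (X₀ ⊗ X₁) X₂ ≫ fst X₀ X₁) 1).coprod
            (BettiUniverse.pull (fst (X₀ ⊗ X₁) X₂ ≫ snd X₀ X₁) 1)).coprod
            (BettiUniverse.pull (snd (X₀ ⊗ X₁) X₂) 1)).prodMap LinearMap.id) := by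
    rw [coprod_comp_prodMap', LinearMap.comp_id, LinearMap.comp_coprod, LinearMap.comp_coprod,
      ← BettiUniverse.pull_comp, ← BettiUniverse.pull_comp, ← BettiUniverse.pull_comp]
  rw [e4]
  exact bijective_coprod_comp_prodMap_id _ _ _ k₄ b3

end Kunneth

/-! ### The trace formula for an arbitrary dimension witness -/

/-- Two smoothness-projectivity witnesses of the same variety have the same dimension (top cohomology:
`H^{2n}(X(ℂ); ℚ)` is a line, `Hᵏ = 0` for `k > 2 dim`). -/
theorem dim_unique {n m : ℕ} {X : SchemeOver ℂ} (h₁ : IsSmoothProjective n X) (h₂ : IsSmoothProjective m X) :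
    n = m := by
  by_contra hne
  rcases Nat.lt_or_gt_of_ne hne with h | h
  · have h1 := finrank_rat_top h₂
    haveI := Literature.AlgebraicGeometry.Motives.ComplexPoints.subsingleton_singularCohomology_of_lt h₁ ℚ
      (show 2 * n < 2 * m by omega)
    rw [Module.finrank_zero_of_subsingleton] at h1
    exact zero_ne_one h1
  · have h1 := finrank_rat_top h₁
    haveI := Literature.AlgebraicGeometry.Motives.ComplexPoints.subsingleton_singularCohomology_of_lt h₂ ℚ
      (show 2 * m < 2 * n by omega)
    rw [Module.finrank_zero_of_subsingleton] at h1
    exact zero_ne_one h1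

/-- `tr ∘ φ^* = det(φ^*|_{H¹}) • tr` for the light trace attached to ANY witness `hX : IsSmoothProjective n X` of
a scheme `X` that IS (`hAX`, in practice `rfl`) the variety of an abelian variety (the model universe carries its own
witness, scheme term and dimension bookkeeping; `dim_unique` identifies `n = A.dim`). -/
theorem tr_comp_pull_eq_det_smul' (A : AbelianVariety ℂ) {X : SchemeOver ℂ} (hAX : A.X = X) {n : ℕ}
    (hX : IsSmoothProjective n X) (φ : X ⟶ X) (k : ℕ) :
    BettiUniverse.tr hX k ∘ₗ BettiUniverse.pull φ k =
      LinearMap.det (BettiUniverse.pull φ 1) • BettiUniverse.tr hX k := by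
  subst hAX
  obtain rfl : n = A.dim := dim_unique hX (AbelianVariety.isSmoothProjective_holds (A := A))
  exact tr_comp_pull_eq_det_smul A φ k

/-! ### `Fact_deg_diag` on `PicardCM.Var` -/

section PicardCMVar

/-- `dim_ℚ H¹(A(ℂ); ℚ) = [K:ℚ]` for the realisation of a CM code `c` and an abstract field `K ≃+* c.E`
(record (iii) `finrank_eq`, universal coefficients `BettiUniverse.finrank_bettiCohomology_eq`). -/
theorem finrank_H1_realisation (h₃ : CMAbelianVarietyRealised) (c : CMCode) {K : Type} [Field K] [NumberField K]
    (e : K ≃+* c.E) :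
    Module.finrank ℚ (bettiCohomology (cmRealisation h₃ c).A 1) = Module.finrank ℚ K := by
  rw [BettiUniverse.finrank_bettiCohomology_eq (cmRealisation h₃ c).isSmoothProjective 1,
    (cmRealisation h₃ c).finrank_eq]
  exact (AddEquiv.toLinearEquiv e.toAddEquiv (fun (q : ℚ) x ↦ map_rat_smul e.toAddEquiv q x)).finrank_eq.symm

/-- **`Fact_deg_diag` of the model universe** `universeOf hHD hI hU h₃`, for the left-nested product `P` of the CM
abelian varieties `Var.cm (c i)` of four codes and a morphism `M : P ⟶ P` acting diagonally by `a ∈ K`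
(`K ≃+* (c i).E` abstract; the package takes `c i := cmCode K (Φ i)`, `e i := cmCodeEquiv K (Φ i)` and the
four intertwining hypotheses are `IsDiagAct`'s at `k = 1`, with `pr4` unfolded). -/
theorem var_deg_diag (hHD : exists_isReal_hodgeModel) (hI : hodgePQ_independent_of_hodgeModel)
    (hU : BallQuotientUniformisedDatum) (h₃ : CMAbelianVarietyRealised) (c : Fin 4 → CMCode) {K : Type} [Field K]
    [NumberField K]
    (e : (i : Fin 4) → (K ≃+* (c i).E)) (a : K)
    (M : Var.Mor hU h₃ (Var.prod (Var.prod (Var.prod (.cm (c 0)) (.cm (c 1))) (.cm (c 2))) (.cm (c 3)))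
      (Var.prod (Var.prod (Var.prod (.cm (c 0)) (.cm (c 1))) (.cm (c 2))) (.cm (c 3))))
    (d : (i : Fin 4) → Var.Mor hU h₃ (.cm (c i)) (.cm (c i)))
    (hd : ∀ i, BettiUniverse.pull (d i) 1 =
      (BettiUniverse.cmEndAction ((cmRealisation h₃ (c i)).θ.comp (e i).toRingHom)
        ((cmRealisation h₃ (c i)).exists_map_comp (e i)) hHD hI (Var.isSmoothProjective hU h₃ (.cm (c i)))).ι a)
    (hM₀ : BettiUniverse.pull M 1 ∘ₗ
        BettiUniverse.pull (Var.comp hU h₃ (Var.fst hU h₃ _ (.cm (c 3)))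
          (Var.comp hU h₃ (Var.fst hU h₃ _ (.cm (c 2))) (Var.fst hU h₃ (.cm (c 0)) (.cm (c 1))))) 1 =
      BettiUniverse.pull (Var.comp hU h₃ (Var.fst hU h₃ _ (.cm (c 3)))
          (Var.comp hU h₃ (Var.fst hU h₃ _ (.cm (c 2))) (Var.fst hU h₃ (.cm (c 0)) (.cm (c 1))))) 1 ∘ₗ
        BettiUniverse.pull (d 0) 1)
    (hM₁ : BettiUniverse.pull M 1 ∘ₗ
        BettiUniverse.pull (Var.comp hU h₃ (Var.fst hU h₃ _ (.cm (c 3)))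
          (Var.comp hU h₃ (Var.fst hU h₃ _ (.cm (c 2))) (Var.snd hU h₃ (.cm (c 0)) (.cm (c 1))))) 1 =
      BettiUniverse.pull (Var.comp hU h₃ (Var.fst hU h₃ _ (.cm (c 3)))
          (Var.comp hU h₃ (Var.fst hU h₃ _ (.cm (c 2))) (Var.snd hU h₃ (.cm (c 0)) (.cm (c 1))))) 1 ∘ₗ
        BettiUniverse.pull (d 1) 1)
    (hM₂ : BettiUniverse.pull M 1 ∘ₗ
        BettiUniverse.pull (Var.comp hU h₃ (Var.fst hU h₃ _ (.cm (c 3))) (Var.snd hU h₃ _ (.cm (c 2)))) 1 =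
      BettiUniverse.pull (Var.comp hU h₃ (Var.fst hU h₃ _ (.cm (c 3))) (Var.snd hU h₃ _ (.cm (c 2)))) 1 ∘ₗ
        BettiUniverse.pull (d 2) 1)
    (hM₃ : BettiUniverse.pull M 1 ∘ₗ BettiUniverse.pull (Var.snd hU h₃ _ (.cm (c 3))) 1 =
      BettiUniverse.pull (Var.snd hU h₃ _ (.cm (c 3))) 1 ∘ₗ BettiUniverse.pull (d 3) 1)
    (k : ℕ) :
    BettiUniverse.tr (Var.isSmoothProjective hU h₃
        (Var.prod (Var.prod (Var.prod (.cm (c 0)) (.cm (c 1))) (.cm (c 2))) (.cm (c 3)))) k ∘ₗ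
        BettiUniverse.pull M k =
      ((Algebra.norm ℚ a) ^ 4) • BettiUniverse.tr (Var.isSmoothProjective hU h₃
        (Var.prod (Var.prod (Var.prod (.cm (c 0)) (.cm (c 1))) (.cm (c 2))) (.cm (c 3)))) k := by
  -- the product abelian variety whose underlying scheme is the model's scheme of `P` (definitionally)
  let B : AbelianVariety ℂ :=
    (((cmRealisation h₃ (c 0)).AV.prod (cmRealisation h₃ (c 1)).AV).prod (cmRealisation h₃ (c 2)).AV).prod
      (cmRealisation h₃ (c 3)).AV
  have htr := tr_comp_pull_eq_det_smul' B rfl (Var.isSmoothProjective hU h₃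
    (Var.prod (Var.prod (Var.prod (.cm (c 0)) (.cm (c 1))) (.cm (c 2))) (.cm (c 3)))) M k
  refine htr.trans ?_
  congr 1
  -- `det M^* = ∏ det (d i)^*`
  haveI h0 : Module.Finite ℚ (bettiCohomology (Var.scheme hU h₃ (.cm (c 0))) 1) := Var.finite hU h₃ _ 1
  haveI h1 : Module.Finite ℚ (bettiCohomology (Var.scheme hU h₃ (.cm (c 1))) 1) := Var.finite hU h₃ _ 1
  haveI h2 : Module.Finite ℚ (bettiCohomology (Var.scheme hU h₃ (.cm (c 2))) 1) := Var.finite hU h₃ _ 1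
  haveI h3 : Module.Finite ℚ (bettiCohomology (Var.scheme hU h₃ (.cm (c 3))) 1) := Var.finite hU h₃ _ 1
  have hΨ := kunneth_one_bijective₄ (Var.isSmoothProjective hU h₃ (.cm (c 0)))
    (Var.isSmoothProjective hU h₃ (.cm (c 1))) (Var.isSmoothProjective hU h₃ (.cm (c 2)))
    (Var.isSmoothProjective hU h₃ (.cm (c 3)))
  refine (det_eq_prod_of_coprod₄ _ _ _ _ hΨ (BettiUniverse.pull (d 0) 1) (BettiUniverse.pull (d 1) 1)
    (BettiUniverse.pull (d 2) 1) (BettiUniverse.pull (d 3) 1) (BettiUniverse.pull M 1) hM₀ hM₁ hM₂ hM₃).trans ?_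
  -- `det (d i)^* = N(a)`
  have hdet : ∀ i, LinearMap.det (BettiUniverse.pull (d i) 1) = Algebra.norm ℚ a := fun i ↦ by
    rw [hd i, BettiUniverse.cmEndAction_ι]
    exact det_eq_norm_of_algHom _ (finrank_H1_realisation h₃ (c i) (e i)) a
  rw [hdet 0, hdet 1, hdet 2, hdet 3]
  ring

end PicardCMVar

end Summit.HodgeConjecture.CorCM.Model

end
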